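import Mathlib
import Summits.Ventures.HodgeRepro.PeriodCloserC7LineClassesFin
import Summits.Ventures.HodgeRepro.PeriodCloserC7ArchSimultaneity

/-!
# PeriodCloserC7LineClassesArch — the archimedean clause `e2_real` from the signature identity at the real places

Blind re-derivation cell `pub-hodge-repro`, seat night-2 (gen 3).  Target tree path
`lean/Summits/Ventures/HodgeRepro/PeriodCloserC7LineClassesArch.lean`.  Joins `PeriodCloserC7LineClassesFin.lean`
(`LocalDischargeFin.e2_real`: (E2) at the real places on admissible data, route-derived) with
`PeriodCloserC7ArchSimultaneity.lean` (`ArchData`, `exists_deltaSign_iff`: (E2) at a real place ⟺ the four products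
`sgn(a_j(w)) · sgn(k_j(w))` agree).

`ArchInterface` attaches to each real place `w` and each datum `d` its archimedean data (the signatures of the four lines
and the signs of their slot exponents — the face's data) and says what TP1's local condition IS there: (9.2) for the two
lines of the torus with the ONE `δ_w` of the datum (`localRootCond_real_iff`, the real-place reading of Borade et al. 2025
Thm 1.4's second bullet through (9.1c)).  Then `e2_real` holds on every datum whose four products agree at every real
place (`e2_real_of_products`), and the field `e2_real` of `LocalDischargeFin` is discharged from the signature identity
`SignatureIdentity` (the route's «N1 at the real places»: ROUTE-B §9.3, the face's `K`-type table of §9.8) —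
`LocalDischargeFin.ofSignature`.

**What this is not.**  The signature identity is the route's reading of the face's archimedean data, taken as a hypothesis
on admissible data; the octic face's exponents are on no page.  Nothing here says anything about the status of the Hodge
conjecture for CM abelian varieties, which is NOT proved.
-/

set_option autoImplicit false

noncomputable section

namespace Summit.Ventures.HodgeRepro.PeriodCloser

open NumberField

variable {L : Type} [Field L] [NumberField L] [IsCMField L]

/-- **The archimedean interface**: the archimedean data of each datum at each real place, the sign of the datum's
`δ_w`, and TP1's local condition at a real place AS (9.2) for the two lines of the torus. -/
structure ArchInterface (I : C7Face L) (Real : Set I.Place) where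
  /-- the archimedean data (signatures, exponent signs) of the datum `d` at the real place `w` -/
  arch : I.Datum → I.Place → ArchData
  /-- the sign `sgn(Im δ_w)` of the datum's `δ` at `w` -/
  deltaSign : I.Datum → I.Place → ℤˣ
  /-- TP1's condition at a real place is (9.2) for the two lines of the torus, with the datum's `δ_w` -/
  localRootCond_real_iff : ∀ (i : Fin 2) (w : I.Place), w ∈ Real → ∀ d : I.Datum,
    I.LocalRootCond i w d ↔ ∀ k : Fin 2, (arch d w).Cond (deltaSign d w) (line i k)
  /-- the datum's `δ_w` is chosen by (9.2) for the line `0` (ROUTE-B §9.3: the sign of `δ_w` is forced) -/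
  deltaSign_spec : ∀ (d : I.Datum) (w : I.Place), w ∈ Real → deltaSign d w = -((arch d w).prod 0)
  /-- (9.1c) at the real place: the local root number of the line `j` is `−sgn(k_j(w)) · sgn(Im δ_w)` (odd exponents,
  the conjugate-symplectic case; gen 0's `epsArch_odd_pos` / `epsArch_odd_neg`) -/
  localRootNumber_real : ∀ (d : I.Datum) (w : I.Place), w ∈ Real → ∀ j : Fin 4,
    I.localRootNumber w (I.chars d j) = -((arch d w).sgnk j) * deltaSign d w

namespace ArchInterface

variable {I : C7Face L} {Real : Set I.Place} (A : ArchInterface I Real)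

/-- **(E2) at a real place from the four products agreeing** (the signature identity at `w`). -/
theorem localRootCond_of_products (d : I.Datum) (w : I.Place) (hw : w ∈ Real)
    (h : ∀ j j' : Fin 4, (A.arch d w).prod j = (A.arch d w).prod j') (i : Fin 2) : I.LocalRootCond i w d := by
  rw [A.localRootCond_real_iff i w hw d]
  intro k
  rw [ArchData.cond_iff, A.deltaSign_spec d w hw, h (line i k) 0]

/-- **The signature identity on admissible data**: at every real place the four products `sgn(a_j(w)) · sgn(k_j(w))`
agree (ROUTE-B §9.3 / §9.8 — N1 at the real places). -/
def SignatureIdentity : Prop :=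
  ∀ d : I.Datum, I.Admissible d → ∀ w : I.Place, w ∈ Real →
    ∀ j j' : Fin 4, (A.arch d w).prod j = (A.arch d w).prod j'

/-- **`e2_real` from the signature identity.** -/
theorem e2_real_of_signature (hS : A.SignatureIdentity) (d : I.Datum) (hd : I.Admissible d) (i : Fin 2)
    (w : I.Place) (hw : w ∈ Real) : I.LocalRootCond i w d :=
  A.localRootCond_of_products d w hw (hS d hd w hw) i

/-- **The finite-place discharge from (E1), (E3), (E5) and the signature identity**: the clause `e2_real` of
`LocalDischargeFin` discharged. -/
theorem _root_.Summit.Ventures.HodgeRepro.PeriodCloser.LocalDischargeFin.ofSignature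
    (hS : A.SignatureIdentity) (e1 : ∀ d : I.Datum, I.Admissible d → I.E1 d)
    (e3 : ∀ d : I.Datum, I.Admissible d → I.E3 d) (e5 : ∀ d : I.Datum, I.Admissible d → I.E5 d) :
    LocalDischargeFin I Real :=
  ⟨e1, fun d hd i w hw => A.e2_real_of_signature hS d hd i w hw, e3, e5⟩

/-- (E2) at a real place is EQUIVALENT to the agreement of the four products, for a datum (both directions of
`exists_deltaSign_iff` with the forced `δ_w`). -/
theorem localRootCond_real_iff_products (d : I.Datum) (w : I.Place) (hw : w ∈ Real) :
    (∀ i : Fin 2, I.LocalRootCond i w d) ↔ ∀ j j' : Fin 4, (A.arch d w).prod j = (A.arch d w).prod j' := by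
  constructor
  · intro h
    have hE : (A.arch d w).E2Real := ⟨A.deltaSign d w, fun j => by
      obtain ⟨i, k, rfl⟩ := exists_line j
      exact (A.localRootCond_real_iff i w hw d).mp (h i) k⟩
    exact (A.arch d w).exists_deltaSign_iff.mp hE
  · exact fun h i => A.localRootCond_of_products d w hw h i

/-- **(E3) at a real place is the signature identity of the exponents**: with (9.1c), `E3At I w d` is
`sgn(k_0) sgn(k_1) = sgn(k_2) sgn(k_3)` — gen 0's «(E3) at the real places = the signature identity of the face». -/
theorem E3At_real_iff (d : I.Datum) (w : I.Place) (hw : w ∈ Real) :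
    E3At I w d ↔ (A.arch d w).sgnk 0 * (A.arch d w).sgnk 1 = (A.arch d w).sgnk 2 * (A.arch d w).sgnk 3 := by
  unfold E3At
  rw [A.localRootNumber_real d w hw 0, A.localRootNumber_real d w hw 1, A.localRootNumber_real d w hw 2,
    A.localRootNumber_real d w hw 3]
  have hss : A.deltaSign d w * A.deltaSign d w = 1 := Int.units_mul_self _
  have key : ∀ a b : ℤˣ, -a * A.deltaSign d w * (-b * A.deltaSign d w) = a * b := fun a b => by
    rw [neg_mul a, neg_mul b, neg_mul_neg, mul_mul_mul_comm, hss, mul_one]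
  rw [key, key]

end ArchInterface

/-! ### (E3) at a real place = the signature identity of the exponents -/

/-- **N1 at a real place is the signature identity of the exponents**: with (9.2) for all four lines, the
discriminant-class identity `sgn(a_0) sgn(a_1) = sgn(a_2) sgn(a_3)` of the two planes at `w` (N1 at `w`, `N1At` of
`PeriodCloserC7ClassesN1.lean` read at a real place) is `sgn(k_0) sgn(k_1) = sgn(k_2) sgn(k_3)` — gen 0's «(E3) at the real
places = the signature identity of the face». -/
theorem ArchData.n1_iff_exponents (A : ArchData) (s : ℤˣ) (hs : ∀ j : Fin 4, A.Cond s j) :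
    (A.sgn 0 * A.sgn 1 = A.sgn 2 * A.sgn 3) ↔ (A.sgnk 0 * A.sgnk 1 = A.sgnk 2 * A.sgnk 3) := by
  have h0 := hs 0
  have h1 := hs 1
  have h2 := hs 2
  have h3 := hs 3
  unfold ArchData.Cond at h0 h1 h2 h3
  rw [h0, h1, h2, h3]
  have hss : s * s = 1 := Int.units_mul_self s
  have key : ∀ a b : ℤˣ, -a * s * (-b * s) = a * b := fun a b => by
    rw [neg_mul a s, neg_mul b s, neg_mul_neg, mul_mul_mul_comm, hss, mul_one]
  rw [key, key]

end Summit.Ventures.HodgeRepro.PeriodCloser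

end
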